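import Literature.AlgebraicGeometry.Frobenioids.ArithmeticFrobenioidThm64ivCompatGeneral
import Literature.AlgebraicGeometry.Frobenioids.ArithmeticFrobenioidThm64AtDataUnconditional
import HarnessLib

/-!
# Frobenioids I, Theorem 6.4 (iv) — the typed schema `Thm64iv` AT THE CONSTRUCTIONS with NO hypothesis on `F₁`
# (node FrdI:Thm6.4(iv) binder-free: the `[IsGalois ℚ F₁]` / `φ : F₁ ≅ F₂` / faithfulness binders dropped)

Mochizuki, *The geometry of Frobenioids I: the general theory*, Kyushu J. Math. **62** (2008) 293–400, §6,
Thm. 6.4 (iv), kurims text p. 115 l. 17–29: "Suppose that `Ψ^rlf` arises from an equivalence of categories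
`Ψ : C₁ ⥲ C₂`. Then `deg(Ψ^rlf) = 1`. If, moreover, there exists a finite extension `L₁ ⊆ F̃₁` of `F₁` which is
Galois over `ℚ`, then the corresponding [via the equivalence `D₁ ⥲ D₂` induced by `Ψ`] finite extension `L₂ ⊆ F̃₂`
of `F₂` is isomorphic to `L₁` in a fashion that is compatible with an isomorphism `F₁ ⥲ F₂`"
[cite: MochizukiFrdI2008, Thm. 6.4 (iv) p.115].

PROOF-ONLY composition (cell abc-iut, layer L1, node FrdI:Thm6.4(iv); seat abc-iut-L1-d3 gen 5; 0 `def`, no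
instance, no notation, no named fact).  The earlier closers of the typed schema at THE constructions carried a binder
for the compatibility clause — `[IsGalois ℚ F₁]` (abc-iut-L1-t3's `Thm64iv_arith_of_datum` / `Thm64iv_schema_arith`,
abc-iut-L1-d7's `Thm64iv_arith_compat`), an input `φ : F₁ ≅ F₂` (`…_of_baseIso`), or faithfulness of `Gal(X.L/ℚ)` on
the infinite places (abc-iut-w4-d090's `Thm64iv_compat_of_cor411iv_of_faithful`).  With the compatibility clause now
proved AT THE DATA for EVERY number field `F₁` (`Thm64iv_arith_compat_general`, GAP-LEDGER G-L1t3-1 #2 closed), all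
of these binders drop:
* `Thm64iv_arith_of_datum_general` — over the [FrdI] Cor. 4.11 (iv) datum `(Ψ^Base, Ψ^Φ, η, Div-clause, π)` of
  `Ψ : C_{K₁/F₁} ⥲ C_{K₂/F₂}`: THE induced `Ψ^rlf`, `picMap` (satisfying `Thm64ii`) with
  `Thm64iv R₁ R₂ Ψrlf picMap deg M₁ M₂ r₁ r₂ Ψ Ψ^Base` for every `deg`, `r₁`, `r₂` — NO hypothesis on `F₁`;
* `Thm64iv_schema_arith_general` — the ∃-packaged form for EVERY `Ψ` (datum from abc-iut-L1-d1's `cor411iv_arith` via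
  abc-iut-L1-d7's `exists_transport_of_cor411iv`) — NO hypothesis on `F₁`;
* `Thm64iv_arith_compat_every` — `Ψ^Base` (an equivalence under `Ψ`) with the printed compatibility clause at every
  `X` with `X.L` Galois over `ℚ` — NO hypothesis on `F₁`;
* `Thm64iv_compat_of_cor411iv` — the same over the typed Cor. 4.11 (iv) node `PreFrobenioidData.Cor411iv` for `Ψ`
  (rationally standard parameters of Thm. 6.4 (i)), binder-free;
* `nonempty_baseRingEquiv_of_galoisObject` — an equivalence of THE arithmetic Frobenioids forces `F₁ ≅ F₂` as soon as
  `D₁` has an object `Spec L₁` with `L₁` Galois over `ℚ` (print's hypothesis), for EVERY `F₁`.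
Nothing here bears on, or takes a side on, [IUTchIII] Cor. 3.12; no statement of the paper is strengthened.
-/

noncomputable section

open scoped NNReal

namespace Literature.AlgebraicGeometry.Frobenioids

open CategoryTheory Opposite Function NumberField Literature.AnabelianGeometry.EtaleTheta

/-! ### Binder form over the Cor. 4.11 (iv) datum -/

section AtData

variable {F₁ : Type} [Field F₁] [NumberField F₁] {K₁ : Type} [Field K₁] [Algebra F₁ K₁] [IsGalois F₁ K₁]
  {F₂ : Type} [Field F₂] [NumberField F₂] {K₂ : Type} [Field K₂] [Algebra F₂ K₂] [IsGalois F₂ K₂]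
  (hΦ₁ : PreFrobenioid.IsPerfFactorialOn (arithDivisorFunctor F₁ K₁))
  (hΦ₂ : PreFrobenioid.IsPerfFactorialOn (arithDivisorFunctor F₂ K₂))
  (Ψ : arithFrobenioid F₁ K₁ ≌ arithFrobenioid F₂ K₂)
  (ΨBase : FinSubextCat F₁ K₁ ⥤ FinSubextCat F₂ K₂) [ΨBase.IsEquivalence]
  (E : (arithFrobenioidOps F₁ K₁).DivisorMonoidIsoOverBase (arithFrobenioidOps F₂ K₂) ΨBase)
  (η : Ψ.functor ⋙ (arithFrobenioidOps F₂ K₂).base ≅ (arithFrobenioidOps F₁ K₁).base ⋙ ΨBase)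
  (hdiv : ∀ ⦃A B : arithFrobenioid F₁ K₁⦄ (φ : A ⟶ B),
    (arithFrobenioidOps F₂ K₂).div (Ψ.functor.map φ) =
      (arithFrobenioidOps F₂ K₂).pull (η.hom.app A)
        (E.iso ((arithFrobenioidOps F₁ K₁).base.obj A) ((arithFrobenioidOps F₁ K₁).div φ)))
  (π : ∀ X : FinSubextCat F₁ K₁, FinitePlace X.L ≃ FinitePlace (ΨBase.obj X).L)
  (hπ : ∀ (X : FinSubextCat F₁ K₁) (w : FinitePlace X.L),
    E.iso X (Multiplicative.ofAdd (EffArithDivisor.single X.L (Sum.inr w))) =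
      Multiplicative.ofAdd (EffArithDivisor.single (ΨBase.obj X).L (Sum.inr (π X w))))

include η hdiv hπ in
/-- **[FrdI] Theorem 6.4 (iv) AS TYPED (`Thm64iv`), AT THE CONSTRUCTIONS, over the Cor. 4.11 (iv) datum of an
equivalence `Ψ : C_{K₁/F₁} ⥲ C_{K₂/F₂}` — for EVERY number field `F₁` (no hypothesis).**  For THE induced `Ψ^rlf`,
`picMap` (which satisfy Thm. 6.4 (ii), `Thm64ii`), the schema `Thm64iv R₁ R₂ Ψrlf picMap deg M₁ M₂ r₁ r₂ Ψ Ψ^Base`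
holds for every `deg` and all comparison functors `r_i` (`R_i = arithRealification hΦ_i`,
`M_i = arithModelFrobenioid F_i K_i`): `deg(Ψ^rlf) = 1` (abc-iut-L1-t3's
`Thm64iv_degOne_and_fieldIso_of_generatorReadings` on the generator readings of
`exists_rlfData_and_generatorReadings_of_datum`), and every `L₁` Galois over `ℚ` corresponds via `Ψ^Base` to
`L₂ ≅ L₁` compatibly with an isomorphism `F₁ ≅ F₂` (`Thm64iv_arith_compat_general`).
[cite: MochizukiFrdI2008, Thm. 6.4 (iv) p.115] -/
theorem Thm64iv_arith_of_datum_general :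
    ∃ (Ψrlf : PreFrobenioid.rlf (ModelFrobenioid.toElem (arithDivisorFunctor F₁ K₁) (unitsFunctor F₁ K₁)
          (divNatTrans F₁ K₁)) hΦ₁ ≌
        PreFrobenioid.rlf (ModelFrobenioid.toElem (arithDivisorFunctor F₂ K₂) (unitsFunctor F₂ K₂)
          (divNatTrans F₂ K₂)) hΦ₂)
      (picMap : ∀ A, (arithRealification hΦ₁).Pic A ≃+ (arithRealification hΦ₂).Pic (Ψrlf.functor.obj A)),
      Nonempty (Ψrlf.functor ⋙ (arithRealification hΦ₂).ops.base ≅ (arithRealification hΦ₁).ops.base ⋙ ΨBase) ∧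
      Thm64ii (arithRealification hΦ₁) (arithRealification hΦ₂) Ψrlf picMap ∧
      ∀ (deg : ℝ)
        (r₁ : arithFrobenioid F₁ K₁ ⥤ PreFrobenioid.rlf (ModelFrobenioid.toElem (arithDivisorFunctor F₁ K₁)
          (unitsFunctor F₁ K₁) (divNatTrans F₁ K₁)) hΦ₁)
        (r₂ : arithFrobenioid F₂ K₂ ⥤ PreFrobenioid.rlf (ModelFrobenioid.toElem (arithDivisorFunctor F₂ K₂)
          (unitsFunctor F₂ K₂) (divNatTrans F₂ K₂)) hΦ₂),
        Thm64iv (arithRealification hΦ₁) (arithRealification hΦ₂) Ψrlf picMap deg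
          (arithModelFrobenioid F₁ K₁) (arithModelFrobenioid F₂ K₂) r₁ r₂ Ψ ΨBase := by
  obtain ⟨Ψrlf, picMap, hηrlf, hT, gen⟩ :=
    exists_rlfData_and_generatorReadings_of_datum hΦ₁ hΦ₂ Ψ ΨBase E η hdiv π hπ
  refine ⟨Ψrlf, picMap, hηrlf, hT, fun deg r₁ r₂ hdeg _hcomm _hsq => ?_⟩
  exact ⟨(Thm64iv_degOne_and_fieldIso_of_generatorReadings (arithRealification hΦ₁) (arithRealification hΦ₂)
      Ψrlf picMap deg hdeg ΨBase π gen).1,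
    fun X hX => Thm64iv_arith_compat_general Ψ E η hdiv X hX⟩

end AtData

/-! ### ∃-packaged forms for every `Ψ`, and the typed Cor. 4.11 (iv) node -/

section Unconditional

variable {F₁ : Type} [Field F₁] [NumberField F₁] {K₁ : Type} [Field K₁] [Algebra F₁ K₁] [IsGalois F₁ K₁]
  {F₂ : Type} [Field F₂] [NumberField F₂] {K₂ : Type} [Field K₂] [Algebra F₂ K₂] [IsGalois F₂ K₂]
  (hΦ₁ : PreFrobenioid.IsPerfFactorialOn (arithDivisorFunctor F₁ K₁))
  (hΦ₂ : PreFrobenioid.IsPerfFactorialOn (arithDivisorFunctor F₂ K₂))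
  (Ψ : arithFrobenioid F₁ K₁ ≌ arithFrobenioid F₂ K₂)

/-- **[FrdI] Theorem 6.4 (iv) AS TYPED, AT THE CONSTRUCTIONS, for EVERY equivalence `Ψ : C_{K₁/F₁} ⥲ C_{K₂/F₂}` and
EVERY number field `F₁` — no hypothesis.**  There are THE induced `Ψ^Base` (an equivalence under `Ψ`), `Ψ^rlf` (an
equivalence over `Ψ^Base`) and `picMap` (satisfying `Thm64ii`) such that
`Thm64iv R₁ R₂ Ψrlf picMap deg M₁ M₂ r₁ r₂ Ψ Ψ^Base` holds for every `deg` and all `r_i` (abc-iut-L1-t3's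
`Thm64iv_schema_arith` with its `[IsGalois ℚ F₁]` binder dropped). [cite: MochizukiFrdI2008, Thm. 6.4 (iv) p.115] -/
theorem Thm64iv_schema_arith_general :
    ∃ (ΨBase : FinSubextCat F₁ K₁ ⥤ FinSubextCat F₂ K₂) (_ : ΨBase.IsEquivalence)
      (_ : Ψ.functor ⋙ (arithFrobenioidOps F₂ K₂).base ≅ (arithFrobenioidOps F₁ K₁).base ⋙ ΨBase)
      (Ψrlf : PreFrobenioid.rlf (ModelFrobenioid.toElem (arithDivisorFunctor F₁ K₁) (unitsFunctor F₁ K₁)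
          (divNatTrans F₁ K₁)) hΦ₁ ≌
        PreFrobenioid.rlf (ModelFrobenioid.toElem (arithDivisorFunctor F₂ K₂) (unitsFunctor F₂ K₂)
          (divNatTrans F₂ K₂)) hΦ₂)
      (picMap : ∀ A, (arithRealification hΦ₁).Pic A ≃+ (arithRealification hΦ₂).Pic (Ψrlf.functor.obj A)),
      Nonempty (Ψrlf.functor ⋙ (arithRealification hΦ₂).ops.base ≅ (arithRealification hΦ₁).ops.base ⋙ ΨBase) ∧
      Thm64ii (arithRealification hΦ₁) (arithRealification hΦ₂) Ψrlf picMap ∧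
      ∀ (deg : ℝ)
        (r₁ : arithFrobenioid F₁ K₁ ⥤ PreFrobenioid.rlf (ModelFrobenioid.toElem (arithDivisorFunctor F₁ K₁)
          (unitsFunctor F₁ K₁) (divNatTrans F₁ K₁)) hΦ₁)
        (r₂ : arithFrobenioid F₂ K₂ ⥤ PreFrobenioid.rlf (ModelFrobenioid.toElem (arithDivisorFunctor F₂ K₂)
          (unitsFunctor F₂ K₂) (divNatTrans F₂ K₂)) hΦ₂),
        Thm64iv (arithRealification hΦ₁) (arithRealification hΦ₂) Ψrlf picMap deg
          (arithModelFrobenioid F₁ K₁) (arithModelFrobenioid F₂ K₂) r₁ r₂ Ψ ΨBase := by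
  obtain ⟨ΨBase, E, η, π, hEq, -, hπ, hdiv⟩ := exists_transport_of_cor411iv Ψ (cor411iv_arith Ψ)
  haveI := hEq
  obtain ⟨Ψrlf, picMap, hη, hT, h⟩ := Thm64iv_arith_of_datum_general hΦ₁ hΦ₂ Ψ ΨBase E η hdiv π hπ
  exact ⟨ΨBase, hEq, η, Ψrlf, picMap, hη, hT, h⟩

/-- **[FrdI] Thm. 6.4 (iv), second clause WITH the compatibility with `F₁ ≅ F₂`, AT THE CONSTRUCTIONS, for EVERY
number field `F₁`** (abc-iut-L1-d7's `Thm64iv_arith_compat` with its `[IsGalois ℚ F₁]` binder dropped): every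
equivalence `Ψ : C_{K₁/F₁} ⥲ C_{K₂/F₂}` of THE arithmetic Frobenioids lies over an equivalence `Ψ^Base : D₁ ⥲ D₂`
(`η : Base₂ ∘ Ψ ≅ Ψ^Base ∘ Base₁`), and for every `X = Spec L₁` with `L₁` Galois over `ℚ` the field
`L₂ := (Ψ^Base X).L` is isomorphic to `L₁` compatibly with an isomorphism `F₁ ⥲ F₂`.
[cite: MochizukiFrdI2008, Thm. 6.4 (iv) p.115] -/
theorem Thm64iv_arith_compat_every :
    ∃ (ΨBase : FinSubextCat F₁ K₁ ⥤ FinSubextCat F₂ K₂)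
      (_ : Ψ.functor ⋙ (arithFrobenioidOps F₂ K₂).base ≅ (arithFrobenioidOps F₁ K₁).base ⋙ ΨBase),
      ΨBase.IsEquivalence ∧
      ∀ X : FinSubextCat F₁ K₁, IsGalois ℚ X.L →
        ∃ (e : X.L ≃+* (ΨBase.obj X).L) (e₀ : F₁ ≃+* F₂),
          ∀ a : F₁, e (algebraMap F₁ X.L a) = algebraMap F₂ (ΨBase.obj X).L (e₀ a) := by
  obtain ⟨ΨBase, E, η, -, hEq, -, -, hdiv⟩ := exists_transport_of_cor411iv Ψ (cor411iv_arith Ψ)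
  haveI := hEq
  exact ⟨ΨBase, η, hEq, fun X hX => Thm64iv_arith_compat_general Ψ E η hdiv X hX⟩

/-- **Over the typed [FrdI] Cor. 4.11 (iv) node** (`PreFrobenioidData.Cor411iv` for `Ψ`, with the rationally
standard parameters of Thm. 6.4 (i)), binder-free: the printed compatibility clause at every `X` with `X.L` Galois
over `ℚ`, for EVERY number field `F₁` (abc-iut-w4-d090's `Thm64iv_compat_of_cor411iv_of_faithful` with its
faithfulness hypothesis dropped). [cite: MochizukiFrdI2008, Thm. 6.4 (iv) p.115] -/
theorem Thm64iv_compat_of_cor411iv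
    (h411iv : PreFrobenioidData.Cor411iv (arithFrobenioidOps F₁ K₁) (arithFrobenioidOps F₂ K₂) Ψ
      (PreFrobenioid.rsParams (arithFrobenioid_isFrobenioid F₁ K₁) fun a 𝔭 => PrimarySupp a 𝔭)
      (PreFrobenioid.rsParams (arithFrobenioid_isFrobenioid F₂ K₂) fun a 𝔭 => PrimarySupp a 𝔭))
    (X : FinSubextCat F₁ K₁) (hX : IsGalois ℚ X.L) :
    ∃ (ΨBase : FinSubextCat F₁ K₁ ⥤ FinSubextCat F₂ K₂) (e : X.L ≃+* (ΨBase.obj X).L) (e₀ : F₁ ≃+* F₂),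
      ∀ a : F₁, e (algebraMap F₁ X.L a) = algebraMap F₂ (ΨBase.obj X).L (e₀ a) := by
  obtain ⟨ΨBase, E, η, -, hEq, -, -, hdiv⟩ := exists_transport_of_cor411iv Ψ h411iv
  haveI := hEq
  exact ⟨ΨBase, Thm64iv_arith_compat_general Ψ E η hdiv X hX⟩

include Ψ in
/-- **An equivalence of THE arithmetic Frobenioids forces `F₁ ≅ F₂`** as soon as `D₁` has an object `X = Spec L₁`
with `L₁` Galois over `ℚ` (print's hypothesis "there exists a finite extension `L₁ ⊆ F̃₁` of `F₁` which is Galois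
over `ℚ`") — for EVERY number field `F₁` (abc-iut-L1-d4's `nonempty_baseRingEquiv_of_arithFrobenioid_equivalence`
had `F₁` Galois over `ℚ`, i.e. `X = Spec F₁`). [cite: MochizukiFrdI2008, Thm. 6.4 (iv) p.115] -/
theorem nonempty_baseRingEquiv_of_galoisObject (X : FinSubextCat F₁ K₁) (hX : IsGalois ℚ X.L) :
    Nonempty (F₁ ≃+* F₂) := by
  obtain ⟨-, -, e₀, -⟩ := Thm64iv_compat_of_cor411iv Ψ (cor411iv_arith Ψ) X hX
  exact ⟨e₀⟩

end Unconditional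

end Literature.AlgebraicGeometry.Frobenioids

end
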